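import Literature.Computability.Complexity.ElementaryRecursive
import Literature.ModelTheory.ExponentialFields.Semialgebraic
import Mathlib.Algebra.BigOperators.Fin
import Mathlib.Data.Real.Basic
import HarnessLib

/-!
# The trace of a `ℚ`-semialgebraic set on rational grids is elementary

For a `ℚ`-semialgebraic set `D ⊆ ℝ^M` and `R : ℕ`, the lattice-point count
`n ↦ #{k ∈ {0, …, n-1}^M : (R kᵢ / n)ᵢ ∈ D}` is a Kalmár elementary function of `n`
(`IsSemialgebraic.elementaryRec_card_gridPoints`).  This is Yoshinaga's Lemma 26
(arXiv:0805.0349, "the function `n ↦ vol(V_n)` is elementary"; Tent–Ziegler 2010, Lemma 4.1, "the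
trace of semialgebraic relations on `ℚ` is lower elementary") for the vertex rule, where no
quantifier elimination is needed: membership of a rational point in a `ℚ`-semialgebraic set is a
Boolean combination of sign conditions `p(x) = 0`, `p(x) > 0` on rational polynomials, and the value
`p(R k / n)` is computed exactly by elementary functions in the coded form `(a - b) / (c + 1)`.

Implementation: the multi-index `k` is coded by `K < n^M` with digits `kᵢ = ⌊K / nⁱ⌋ mod n`
(`finFunctionFinEquiv`), and `(n, K)` by `Nat.pair`; `IsCoded f` records that a real-valued
function of `(n, K)` has the form `(A - B)/(C + 1)` with `A B C` elementary; it is closed under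
constants, sums, products and contains the coordinates of the grid point (`IsCoded.coord`), hence
contains `(n, K) ↦ p(x_{n,K})` for every rational polynomial `p` (`IsCoded.aeval`); sign conditions
on coded functions are elementary predicates, and an induction over the generating Boolean algebra
concludes.

## References

* M. Yoshinaga, *Periods and elementary real numbers*, arXiv:0805.0349 (2008), Lemma 26 and §3.3.
* K. Tent, M. Ziegler, *Computable functions of reals*, Münster J. Math. 3 (2010), Lemma 4.1.
-/

noncomputable section

open Finset Literature.Computability.Complexity

namespace Literature.NumberTheory.Transcendental

variable {M : ℕ}

/-- The rational grid point coded by `(n, K)`: coordinates `(R / n) · (⌊K / nⁱ⌋ mod n)`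
(for `n = 0` this is the origin, by `x / 0 = 0`). [cite: Yoshinaga2008, §3.4] -/
def codedGridPoint (M R n K : ℕ) : Fin M → ℝ :=
  fun i => ((R : ℝ) / n) * ((K / n ^ (i : ℕ) % n : ℕ) : ℝ)

/-- A real-valued function of the code `(n, K)` is *coded* if it is `(A - B) / (C + 1)` for Kalmár
elementary `A B C` (read at `Nat.pair n K`): Yoshinaga's elementary maps `ℕ → ℚ` (Def. 11) with a
sign. [cite: Yoshinaga2008, Definition 11] -/
def IsCoded (f : ℕ → ℕ → ℝ) : Prop :=
  ∃ A B C : ℕ → ℕ, ElementaryRec A ∧ ElementaryRec B ∧ ElementaryRec C ∧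
    ∀ n K, f n K = ((A (Nat.pair n K) : ℝ) - B (Nat.pair n K)) / ((C (Nat.pair n K) : ℝ) + 1)

namespace IsCoded

/-- Rational constants are coded: `q = (num⁺ - num⁻) / ((den - 1) + 1)`.
[cite: Yoshinaga2008, Definition 11] -/
theorem const (q : ℚ) : IsCoded fun _ _ => (q : ℝ) := by
  refine ⟨fun _ => q.num.toNat, fun _ => (-q.num).toNat, fun _ => q.den - 1,
    ElementaryRec.const _, ElementaryRec.const _, ElementaryRec.const _, fun n K => ?_⟩
  have hden : ((q.den - 1 : ℕ) : ℝ) + 1 = q.den := by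
    rw [Nat.cast_sub q.den_pos, Nat.cast_one, sub_add_cancel]
  have hnum : ((q.num.toNat : ℕ) : ℝ) - ((-q.num).toNat : ℕ) = q.num := by
    have h : ((q.num.toNat : ℤ) - ((-q.num).toNat : ℤ)) = q.num := Int.toNat_sub_toNat_neg q.num
    exact_mod_cast h
  rw [hden, hnum]
  show (q : ℝ) = (q.num : ℝ) / (q.den : ℝ)
  rw [← Rat.cast_intCast, ← Rat.cast_natCast, ← Rat.cast_div, Rat.num_div_den]

/-- Coded functions are closed under addition (common denominator `(C+1)(C'+1)`).
[cite: Yoshinaga2008, Proposition 10] -/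
theorem add {f g : ℕ → ℕ → ℝ} (hf : IsCoded f) (hg : IsCoded g) : IsCoded fun n K => f n K + g n K := by
  obtain ⟨A, B, C, hA, hB, hC, h⟩ := hf
  obtain ⟨A', B', C', hA', hB', hC', h'⟩ := hg
  refine ⟨fun c => A c * (C' c + 1) + A' c * (C c + 1), fun c => B c * (C' c + 1) + B' c * (C c + 1),
    fun c => (C c + 1) * (C' c + 1) - 1, ?_, ?_, ?_, fun n K => ?_⟩
  · exact (hA.mul' hC'.succ').add' (hA'.mul' hC.succ')
  · exact (hB.mul' hC'.succ').add' (hB'.mul' hC.succ')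
  · exact (hC.succ'.mul' hC'.succ').tsub' (ElementaryRec.const 1)
  · beta_reduce
    rw [h, h']
    set c := Nat.pair n K
    have hden : (((C c + 1) * (C' c + 1) - 1 : ℕ) : ℝ) + 1 = ((C c : ℝ) + 1) * ((C' c : ℝ) + 1) := by
      rw [Nat.cast_sub (Nat.one_le_iff_ne_zero.2 (by positivity))]
      push_cast
      ring
    rw [hden]
    have h1 : ((C c : ℝ) + 1) ≠ 0 := by positivity
    have h2 : ((C' c : ℝ) + 1) ≠ 0 := by positivity
    push_cast
    field_simp
    ring

/-- Coded functions are closed under multiplication: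
`(a - b)(a' - b') = (a a' + b b') - (a b' + b a')`. [cite: Yoshinaga2008, Proposition 10] -/
theorem mul {f g : ℕ → ℕ → ℝ} (hf : IsCoded f) (hg : IsCoded g) : IsCoded fun n K => f n K * g n K := by
  obtain ⟨A, B, C, hA, hB, hC, h⟩ := hf
  obtain ⟨A', B', C', hA', hB', hC', h'⟩ := hg
  refine ⟨fun c => A c * A' c + B c * B' c, fun c => A c * B' c + B c * A' c,
    fun c => (C c + 1) * (C' c + 1) - 1, ?_, ?_, ?_, fun n K => ?_⟩
  · exact (hA.mul' hA').add' (hB.mul' hB')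
  · exact (hA.mul' hB').add' (hB.mul' hA')
  · exact (hC.succ'.mul' hC'.succ').tsub' (ElementaryRec.const 1)
  · beta_reduce
    rw [h, h']
    set c := Nat.pair n K
    have hden : (((C c + 1) * (C' c + 1) - 1 : ℕ) : ℝ) + 1 = ((C c : ℝ) + 1) * ((C' c : ℝ) + 1) := by
      rw [Nat.cast_sub (Nat.one_le_iff_ne_zero.2 (by positivity))]
      push_cast
      ring
    rw [hden]
    have h1 : ((C c : ℝ) + 1) ≠ 0 := by positivity
    have h2 : ((C' c : ℝ) + 1) ≠ 0 := by positivity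
    push_cast
    field_simp
    ring

/-- The coordinates of the coded grid point are coded: `(R / n) d = (R d · min n 1 - 0)/((n ∸ 1) + 1)`
with the digit `d = ⌊K / nⁱ⌋ mod n` elementary. [cite: Yoshinaga2008, Lemma 26] -/
theorem coord (M R : ℕ) (i : Fin M) : IsCoded fun n K => codedGridPoint M R n K i := by
  refine ⟨fun c => R * (c.unpair.2 / c.unpair.1 ^ (i : ℕ) % c.unpair.1) * min c.unpair.1 1,
    fun _ => 0, fun c => c.unpair.1 - 1, ?_, ElementaryRec.const 0,
    ElementaryRec.left.tsub' (ElementaryRec.const 1), fun n K => ?_⟩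
  · exact ((ElementaryRec.const R).mul' (ElementaryRec.digit ElementaryRec.right ElementaryRec.left _)).mul'
      (ElementaryRec.left.min' (ElementaryRec.const 1))
  · simp only [Nat.unpair_pair, codedGridPoint, Nat.cast_zero, sub_zero]
    rcases Nat.eq_zero_or_pos n with rfl | hn
    · simp
    · have hmin : min n 1 = 1 := min_eq_right hn
      have hn1 : ((n - 1 : ℕ) : ℝ) + 1 = n := by
        rw [Nat.cast_sub hn, Nat.cast_one, sub_add_cancel]
      rw [hmin, mul_one, hn1]
      push_cast
      ring

/-- The value of a rational polynomial at the coded grid point is a coded function of `(n, K)`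
(induction on the polynomial). [cite: Yoshinaga2008, Lemma 26] -/
theorem aeval (M R : ℕ) (p : MvPolynomial (Fin M) ℚ) :
    IsCoded fun n K => MvPolynomial.aeval (codedGridPoint M R n K) p := by
  induction p using MvPolynomial.induction_on with
  | C q => simpa using IsCoded.const q
  | add p q hp hq => simpa using hp.add hq
  | mul_X p i hp => simpa using hp.mul (IsCoded.coord M R i)

/-- The zero set of a coded function is an elementary predicate (`(A - B)/(C+1) = 0 ↔ A = B`).
[cite: Yoshinaga2008, Example 7 (4)] -/
theorem elementaryRec_ite_eq_zero {f : ℕ → ℕ → ℝ} (hf : IsCoded f) :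
    ElementaryRec fun c => if f c.unpair.1 c.unpair.2 = 0 then 1 else 0 := by
  obtain ⟨A, B, C, hA, hB, hC, h⟩ := hf
  refine (ElementaryRec.ite_eq hA hB).of_eq fun c => ?_
  have hc : Nat.pair c.unpair.1 c.unpair.2 = c := Nat.pair_unpair c
  have hpos : (0 : ℝ) < (C c : ℝ) + 1 := by positivity
  have key : f c.unpair.1 c.unpair.2 = 0 ↔ A c = B c := by
    rw [h, hc, div_eq_zero_iff, sub_eq_zero]
    constructor
    · rintro (h1 | h1)
      · exact_mod_cast h1
      · exact absurd h1 hpos.ne'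
    · intro h1; left; exact_mod_cast h1
  by_cases h1 : A c = B c
  · rw [if_pos h1, if_pos (key.2 h1)]
  · rw [if_neg h1, if_neg (fun h2 => h1 (key.1 h2))]

/-- The positivity set of a coded function is an elementary predicate
(`0 < (A - B)/(C+1) ↔ B < A`). [cite: Yoshinaga2008, Example 7 (4)] -/
theorem elementaryRec_ite_pos {f : ℕ → ℕ → ℝ} (hf : IsCoded f) :
    ElementaryRec fun c => if 0 < f c.unpair.1 c.unpair.2 then 1 else 0 := by
  obtain ⟨A, B, C, hA, hB, hC, h⟩ := hf
  refine (ElementaryRec.ite_lt hB hA).of_eq fun c => ?_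
  have hc : Nat.pair c.unpair.1 c.unpair.2 = c := Nat.pair_unpair c
  have hpos : (0 : ℝ) < (C c : ℝ) + 1 := by positivity
  have key : 0 < f c.unpair.1 c.unpair.2 ↔ B c < A c := by
    rw [h, hc, div_pos_iff_of_pos_right hpos, sub_pos]
    exact ⟨fun h1 => by exact_mod_cast h1, fun h1 => by exact_mod_cast h1⟩
  by_cases h1 : B c < A c
  · rw [if_pos h1, if_pos (key.2 h1)]
  · rw [if_neg h1, if_neg (fun h2 => h1 (key.1 h2))]

end IsCoded

/-- **Membership of coded grid points in a `ℚ`-semialgebraic set is an elementary predicate**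
(induction over the generating Boolean algebra; Yoshinaga 2008, Lemma 26 / Tent–Ziegler 2010,
Lemma 4.1, vertex-rule form). [cite: Yoshinaga2008, Lemma 26] -/
theorem _root_.Literature.ModelTheory.ExponentialFields.IsSemialgebraic.elementaryRec_ite_codedGridPoint_mem
    {D : Set (Fin M → ℝ)} (hD : Literature.ModelTheory.ExponentialFields.IsSemialgebraic ℚ D)
    (R : ℕ) [DecidablePred (· ∈ D)] :
    ElementaryRec fun c => if codedGridPoint M R c.unpair.1 c.unpair.2 ∈ D then 1 else 0 := by
  classical
  -- strengthen to all members of the generated Boolean algebra, with their own decidability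
  suffices H : ∀ s : Set (Fin M → ℝ), Literature.ModelTheory.ExponentialFields.IsSemialgebraic ℚ s →
      ElementaryRec fun c => if codedGridPoint M R c.unpair.1 c.unpair.2 ∈ s then 1 else 0 from
    (H D hD).of_eq fun c => by
      by_cases hc : codedGridPoint M R c.unpair.1 c.unpair.2 ∈ D <;> simp [hc]
  intro s hs
  induction hs using BooleanSubalgebra.closure_bot_sup_induction with
  | mem s hs =>
    rcases hs with ⟨p, rfl⟩ | ⟨p, rfl⟩
    · exact (IsCoded.aeval M R p).elementaryRec_ite_eq_zero.of_eq fun c => by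
        by_cases hc : MvPolynomial.aeval (codedGridPoint M R c.unpair.1 c.unpair.2) p = 0 <;> simp [hc]
    · exact (IsCoded.aeval M R p).elementaryRec_ite_pos.of_eq fun c => by
        by_cases hc : 0 < MvPolynomial.aeval (codedGridPoint M R c.unpair.1 c.unpair.2) p <;> simp [hc]
  | bot => exact (ElementaryRec.const 0).of_eq fun c => by simp
  | sup s _ t _ hs ht =>
    exact (ElementaryRec.ite_or hs ht).of_eq fun c => by
      by_cases h1 : codedGridPoint M R c.unpair.1 c.unpair.2 ∈ s <;>
        by_cases h2 : codedGridPoint M R c.unpair.1 c.unpair.2 ∈ t <;>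
          simp [h1, h2, Set.sup_eq_union]
  | compl s _ hs =>
    exact (ElementaryRec.ite_not hs).of_eq fun c => by
      by_cases h1 : codedGridPoint M R c.unpair.1 c.unpair.2 ∈ s <;> simp [h1]

/-- Digits of the code: the multi-index `k` is recovered from `K = finFunctionFinEquiv k` by
`kᵢ = ⌊K / nⁱ⌋ mod n`, so the coded grid point of `(n, K)` is the grid point `(R kᵢ / n)ᵢ`.
[folklore] -/
theorem codedGridPoint_finFunctionFinEquiv (R : ℕ) {n : ℕ} (k : Fin M → Fin n) :
    codedGridPoint M R n (finFunctionFinEquiv k : ℕ) = fun i => ((R : ℝ) / n) * ((k i : ℕ) : ℝ) := by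
  funext i
  simp only [codedGridPoint]
  congr 2
  have h1 : ((finFunctionFinEquiv.symm (finFunctionFinEquiv k)) i : ℕ) =
      (finFunctionFinEquiv k : ℕ) / n ^ (i : ℕ) % n := finFunctionFinEquiv_symm_apply_val _ _
  rw [Equiv.symm_apply_apply] at h1
  exact h1.symm

open Classical in
/-- **Lattice-point counts of a `ℚ`-semialgebraic set are elementary** (Yoshinaga 2008, Lemma 26,
vertex-rule form; Tent–Ziegler 2010, Lemma 4.1): for `D ⊆ ℝ^M` `ℚ`-semialgebraic and `R : ℕ`, the
function `n ↦ #{k ∈ {0,…,n-1}^M : (R kᵢ / n)ᵢ ∈ D}` is Kalmár elementary.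
[cite: Yoshinaga2008, Lemma 26] -/
theorem _root_.Literature.ModelTheory.ExponentialFields.IsSemialgebraic.elementaryRec_card_gridPoints
    {D : Set (Fin M → ℝ)} (hD : Literature.ModelTheory.ExponentialFields.IsSemialgebraic ℚ D) (R : ℕ) :
    ElementaryRec fun n => (Finset.univ.filter fun k : Fin M → Fin n =>
      (fun i => ((R : ℝ) / n) * ((k i : ℕ) : ℝ)) ∈ D).card := by
  have hχ := hD.elementaryRec_ite_codedGridPoint_mem R
  have hcount : ElementaryRec fun n =>
      ((range (n ^ M)).filter fun K => codedGridPoint M R n K ∈ D).card :=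
    ElementaryRec.card_filter_range (p := fun n K => codedGridPoint M R n K ∈ D)
      (hχ.of_eq fun c => by simp) (ElementaryRec.id'.pow' (ElementaryRec.const M))
  refine hcount.of_eq fun n => ?_
  rw [Finset.card_filter, Finset.card_filter, ← Fin.sum_univ_eq_sum_range
    (f := fun K => if codedGridPoint M R n K ∈ D then 1 else 0),
    ← Equiv.sum_comp finFunctionFinEquiv]
  refine Finset.sum_congr rfl fun k _ => ?_
  rw [codedGridPoint_finFunctionFinEquiv]

end Literature.NumberTheory.Transcendental
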